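import Literature.Topology.FourManifolds.BranchedDoubleCoverCovering
import Literature.Topology.FourManifolds.BranchedDoubleCoverUnknot
import Literature.Topology.FourManifolds.ChargedHomotopySphereProofs
import Literature.Topology.FourManifolds.GluckTwistProofs
import HarnessLib

/-!
# A branched double cover of `S⁴` along a 2-knot is a closed manifold: Hausdorff, compact,
# second countable

Topic `Literature/Topology/FourManifolds`; theorems about the relational predicate
`IsBranchedDoubleCover IX X K ι q` of `BranchedDoubleCoverTwoKnot.lean`.

The named fact `Kuhrman2025_thm3_chargedHomotopySphere` (`ChargedHomotopySphere.lean`) and the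
glue theorem `Kuhrman2025_thm3_chargedHomotopySphere_of_cover` quantify over a manifold `M`
carrying `T2Space` and `SecondCountableTopology` instances; the witnesses in the printed proof
are the branched double covers `Σ₂(S⁴, K)`, "closed 4-manifolds" (Gompf–Stipsicz (1999), §6.3;
Kuhrman (2025), §2.2). This file proves that these side conditions are AUTOMATIC for the
tree's predicate:

* `IsBranchedDoubleCover.t2Space` — `X` is Hausdorff (points in different fibres are separated
  through `q`; the two points `x ≠ ι x` of a fibre off the knot by a domain of injectivity `U`
  of `q` avoiding the knot and its translate `ι(U)`, which are disjoint);
* `IsBranchedDoubleCover.isCompact_preimage` — **the covering off the knot is proper**: the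
  preimage of a compact `C ⊆ S⁴ ∖ K(S²)` is compact (finitely many evenly covered compact
  neighbourhoods, each with preimage `≅ N × Bool`);
* `IsBranchedDoubleCover.compactSpace` — `X` is compact: `X = j(S² × D̄²) ∪ q⁻¹(S⁴ ∖ ν(S² × D²))`
  with `j` the model embedding over the tube `ν` (first piece a continuous image of a compact
  set, second piece compact by properness, `ν(S² × D²)` being open by invariance of domain
  `TwoKnot.TubularNbhd.isOpen_image`);
* `IsBranchedDoubleCover.secondCountableTopology` — for a second countable model space `HX`,
  `X` is second countable (compact charted spaces are, `ChartedSpace.secondCountable_of_sigmaCompact`);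
* `Kuhrman2025_thm3_chargedHomotopySphere_of_cover'` — the glue theorem of
  `ChargedHomotopySphereProofs.lean` with its `T2Space`/`SecondCountableTopology` hypotheses
  discharged: a branched double cover `(X, ι, q)` of `S⁴` along a 2-knot, `X` a `C^∞`
  4-manifold homotopy equivalent to `S⁴` whose deck involution preserves no metric of positive
  scalar curvature, proves `Kuhrman2025_thm3_chargedHomotopySphere`.

Everything is a theorem; no named facts.

## References

* R. E. Gompf, A. I. Stipsicz, *4-Manifolds and Kirby Calculus* (1999), §6.3. [GompfStipsicz1999]
* A. Hatcher, *Algebraic Topology*, CUP (2002), §1.3 (finite covers are proper). [HatcherAT2002]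
* J. Kuhrman, arXiv:2507.03798 (2025), §2.2. [Kuhrman2025]
-/

open scoped Manifold ContDiff Topology
open Function Set

noncomputable section

namespace Literature.Topology.FourManifolds

/-- **Evenly covered compact sets have compact preimage** (the fibre being compact): if
`H : f⁻¹(U) ≃ₜ U × I` commutes with the projections, `I` is compact and `N ⊆ U` is compact, then
`f⁻¹(N)` is compact. [cite: HatcherAT2002, §1.3] -/
theorem isCompact_preimage_of_trivialization {E B I : Type*} [TopologicalSpace E]
    [TopologicalSpace B] [TopologicalSpace I] [CompactSpace I] {f : E → B} {U : Set B}
    (H : f ⁻¹' U ≃ₜ U × I) (hH : ∀ y, (H y).1.1 = f y) {N : Set B} (hN : IsCompact N)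
    (hNU : N ⊆ U) : IsCompact (f ⁻¹' N) := by
  have hNc : IsCompact (Subtype.val ⁻¹' N : Set U) := by
    rw [Subtype.isCompact_iff, Subtype.image_preimage_coe, inter_eq_right.2 hNU]
    exact hN
  have hP : IsCompact (H.symm '' ((Subtype.val ⁻¹' N : Set U) ×ˢ (univ : Set I))) :=
    (hNc.prod isCompact_univ).image H.symm.continuous
  have hE : f ⁻¹' N = Subtype.val '' (H.symm '' ((Subtype.val ⁻¹' N : Set U) ×ˢ univ)) := by
    ext y
    constructor
    · intro hy
      have hyU : y ∈ f ⁻¹' U := hNU hy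
      refine ⟨⟨y, hyU⟩, ⟨H ⟨y, hyU⟩, ⟨?_, mem_univ _⟩, H.symm_apply_apply _⟩, rfl⟩
      change ((H ⟨y, hyU⟩).1 : B) ∈ N
      rw [hH]
      exact hy
    · rintro ⟨y', ⟨p, ⟨hp, -⟩, rfl⟩, rfl⟩
      change f (H.symm p : E) ∈ N
      rw [← hH, H.apply_symm_apply]
      exact hp
  rw [hE]
  exact hP.image continuous_subtype_val

namespace IsBranchedDoubleCover

variable {EX HX : Type*} [NormedAddCommGroup EX] [NormedSpace ℝ EX] [TopologicalSpace HX]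
  {IX : ModelWithCorners ℝ EX HX} {X : Type*} [TopologicalSpace X] [ChartedSpace HX X]
  {K : TwoKnot} {ι : X → X} {q : X → Metric.sphere (0 : EuclideanSpace ℝ (Fin 5)) 1}

/-- **A branched double cover of `S⁴` is Hausdorff.** Points with different images are separated
through the continuous `q` (`S⁴` is Hausdorff); the two points `x ≠ ι x` of a fibre off the
knot by `U` and `ι(U)`, where `U ∋ x` is a domain on which `q` is injective (local
diffeomorphism clause) avoiding the closed set `q⁻¹(K(S²))`: a point of `U ∩ ι(U)` would be a
fixed point of `ι` off the knot. [cite: GompfStipsicz1999, §6.3] -/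
theorem t2Space (h : IsBranchedDoubleCover IX X K ι q) : T2Space X := by
  refine ⟨fun x y hxy ↦ ?_⟩
  by_cases hq : q x = q y
  · -- same fibre: `y = ι x`, `x` not fixed, so `q x ∉ K(S²)`
    have hyx : y = ι x := (h.eq_or_eq_deck_of_proj_eq x y hq.symm).resolve_left (Ne.symm hxy)
    have hK : q x ∉ range K := fun hmem ↦ hxy (((h.isFixedPt_iff x).2 hmem).symm.trans hyx.symm)
    obtain ⟨e, hxe, heq⟩ := h.exists_openPartialHomeomorph_eqOn hK
    set U : Set X := e.source ∩ q ⁻¹' (range K)ᶜ with hU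
    have hUo : IsOpen U :=
      e.open_source.inter (K.isClosed_range.isOpen_compl.preimage h.continuous_proj)
    have hxU : x ∈ U := ⟨hxe, hK⟩
    refine ⟨U, ι ⁻¹' U, hUo, hUo.preimage h.continuous_deck, hxU, ?_, ?_⟩
    · show ι y ∈ U
      rwa [hyx, h.deck_deck]
    · rw [Set.disjoint_left]
      intro z hzU hzι
      have hιz : ι z ∈ U := hzι
      have hfix : ι z = z :=
        e.injOn hιz.1 hzU.1 (by rw [← heq hιz.1, ← heq hzU.1, h.proj_deck])
      exact hzU.2 ((h.isFixedPt_iff z).1 hfix)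
  · obtain ⟨A, B, hA, hB, hxA, hyB, hAB⟩ := t2_separation hq
    exact ⟨q ⁻¹' A, q ⁻¹' B, hA.preimage h.continuous_proj, hB.preimage h.continuous_proj, hxA,
      hyB, hAB.preimage q⟩

/-- **The covering off the knot is proper**: the preimage under `q` of a compact set missing
the knot is compact (finitely many evenly covered compact neighbourhoods, each with compact
preimage `≅ N × Bool`). [cite: HatcherAT2002, §1.3] -/
theorem isCompact_preimage (h : IsBranchedDoubleCover IX X K ι q)
    {C : Set (Metric.sphere (0 : EuclideanSpace ℝ (Fin 5)) 1)} (hC : IsCompact C)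
    (hCK : C ⊆ (range K)ᶜ) : IsCompact (q ⁻¹' C) := by
  haveI := h.t2Space
  -- evenly covered compact neighbourhoods
  have hnb : ∀ b ∈ C, ∃ N : Set (Metric.sphere (0 : EuclideanSpace ℝ (Fin 5)) 1),
      b ∈ interior N ∧ IsCompact (q ⁻¹' N) := by
    intro b hb
    obtain ⟨-, V, hbV, hVo, -, H, hH⟩ := h.isEvenlyCovered (hCK hb)
    obtain ⟨N, hNc, hbN, hNV⟩ := exists_compact_subset hVo hbV
    exact ⟨N, hbN, isCompact_preimage_of_trivialization H hH hNc hNV⟩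
  choose! N hN using hnb
  obtain ⟨t, hcover⟩ :=
    hC.elim_nhds_subcover' (fun b _ ↦ interior (N b)) fun b hb ↦
      isOpen_interior.mem_nhds (hN b hb).1
  have hbig : IsCompact (⋃ b ∈ t, q ⁻¹' N b.1) :=
    t.isCompact_biUnion fun b _ ↦ (hN b b.2).2
  refine hbig.of_isClosed_subset (hC.isClosed.preimage h.continuous_proj) fun y hy ↦ ?_
  obtain ⟨b, hbt, hyb⟩ := mem_iUnion₂.1 (hcover hy)
  exact mem_iUnion₂.2 ⟨b, hbt, show q y ∈ N b from interior_subset hyb⟩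

/-- **A branched double cover of `S⁴` is compact**: `X = j(S² × D̄²) ∪ q⁻¹(S⁴ ∖ ν(S² × D²))`
for the model embedding `j` over the tube `ν` — a continuous image of the compact `S² × D̄²`,
and the (proper) preimage of a closed, hence compact, subset of `S⁴` missing the knot
(`ν(S² × D²) ⊇ K(S²)` is open by invariance of domain). Gompf–Stipsicz (1999), §6.3 ("closed
4-manifold `Σ₂`"). [cite: GompfStipsicz1999, §6.3] -/
theorem compactSpace (h : IsBranchedDoubleCover IX X K ι q) : CompactSpace X := by
  obtain ⟨ν, j, hj, -, hqj, -, hrange⟩ := h.exists_model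
  -- the compact model piece `j (S² × closed unit disc)`
  have hA : IsCompact (j '' (univ ×ˢ Metric.closedBall (0 : EuclideanSpace ℝ (Fin 2)) 1)) :=
    (isCompact_univ.prod (isCompact_closedBall _ _)).image hj.isEmbedding.continuous
  -- the compact complement of the open tube of radius one
  set T : Set (Metric.sphere (0 : EuclideanSpace ℝ (Fin 5)) 1) :=
    ν.toFun '' (univ ×ˢ Metric.ball (0 : EuclideanSpace ℝ (Fin 2)) 1) with hT
  have hTo : IsOpen T := ν.isOpen_image (isOpen_univ.prod Metric.isOpen_ball)
  have hKT : range K ⊆ T := by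
    rintro _ ⟨p, rfl⟩
    exact ⟨(p, 0), ⟨mem_univ _, Metric.mem_ball_self one_pos⟩, ν.apply_zero p⟩
  have hL : IsCompact (q ⁻¹' Tᶜ) :=
    h.isCompact_preimage hTo.isClosed_compl.isCompact fun b hb hbK ↦ hb (hKT hbK)
  refine ⟨(hA.union hL).of_isClosed_subset isClosed_univ fun y _ ↦ ?_⟩
  by_cases hy : q y ∈ T
  · left
    obtain ⟨⟨p', w'⟩, ⟨-, hw'⟩, hyw⟩ := hy
    have hyν : y ∈ q ⁻¹' range ν.toFun := ⟨(p', w'), hyw⟩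
    rw [← hrange] at hyν
    obtain ⟨⟨p, w⟩, rfl⟩ := hyν
    refine ⟨(p, w), ⟨mem_univ _, ?_⟩, rfl⟩
    have hsq : normalSq w = w' := by
      have h1 : ν.toFun (p, normalSq w) = ν.toFun (p', w') := by rw [← hqj, hyw]
      exact (Prod.mk.inj (ν.injective h1)).2
    rw [Metric.mem_ball, dist_zero_right] at hw'
    rw [Metric.mem_closedBall, dist_zero_right]
    have hn : ‖w‖ ^ 2 < 1 := by rw [← BranchedUnknot.norm_normalSq, hsq]; exact hw'
    nlinarith [norm_nonneg w]
  · right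
    exact hy

/-- **A branched double cover of `S⁴` is second countable** (for a second countable model
space, e.g. `EuclideanSpace ℝ (Fin 4)`): compact charted spaces are.
[cite: GompfStipsicz1999, §6.3] -/
theorem secondCountableTopology [SecondCountableTopology HX] (h : IsBranchedDoubleCover IX X K ι q) :
    SecondCountableTopology X := by
  haveI := h.compactSpace
  exact ChartedSpace.secondCountable_of_sigmaCompact HX X

end IsBranchedDoubleCover

/-! ## The glue theorem without side instances -/

section Glue

open Literature.Geometry.Lorentzian

/-- **`ChargedCover → ChargedSphere`, side instances discharged.** If a branched double cover
`(X, ι, q)` of `S⁴` along some 2-knot — `X` any `C^∞` 4-manifold, automatically Hausdorff and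
second countable by `IsBranchedDoubleCover.t2Space` / `.secondCountableTopology` — is homotopy
equivalent to `S⁴` and its deck involution preserves no Riemannian metric of positive scalar
curvature, then `Kuhrman2025_thm3_chargedHomotopySphere` holds (Kuhrman (2025), Proof of
Theorems 2 and 3, p. 11, with the two gauge-theoretic/topological inputs left as hypotheses:
Theorem 1 and the real Seiberg–Witten obstruction).
[cite: Kuhrman2025, Proof of Theorems 2 and 3 (p. 11)] -/
theorem Kuhrman2025_thm3_chargedHomotopySphere_of_cover' {X : Type} [TopologicalSpace X]
    [ChartedSpace (EuclideanSpace ℝ (Fin 4)) X] [IsManifold (𝓡 4) ∞ X]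
    {K : TwoKnot} {ι : X → X} {q : X → Metric.sphere (0 : EuclideanSpace ℝ (Fin 5)) 1}
    (h : IsBranchedDoubleCover (𝓡 4) X K ι q)
    (he : ContinuousMap.HomotopyEquiv X (Metric.sphere (0 : EuclideanSpace ℝ (Fin 5)) 1))
    (hpsc : ∀ (g : PseudoRiemannianMetric (𝓡 4) ∞ (EuclideanSpace ℝ (Fin 4))
      (TangentSpace (𝓡 4) : X → Type _))
      (_ : g.HasLeviCivita), g.IsRiemannian → (∀ x, 0 < g.scalarCurvature x) →
        ¬ ∀ y, pullbackBilin (I := 𝓡 4) (I' := 𝓡 4) ι g.val y = g.val y) :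
    Kuhrman2025_thm3_chargedHomotopySphere := by
  haveI := h.t2Space
  haveI := h.secondCountableTopology
  exact Kuhrman2025_thm3_chargedHomotopySphere_of_cover h he hpsc

end Glue

end Literature.Topology.FourManifolds
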